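import Mathlib
import Summits.NavierStokesRegularity.NavierStokesRegularity.Theorems.EulerZoomLiouvillePowerGaugeEulerLiouvilleHoopSliceSides
import Summits.NavierStokesRegularity.NavierStokesRegularity.Theorems.EulerZoomLiouvillePowerGaugeEulerLiouvilleHoopBoxAssembly
import HarnessLib

/-!
# THE HOOP INEQUALITY `HoopCore.HoopInequality` (K-HOOP, HOOP-NOTE §4) — final assembly (c)(ii)
# (route `EulerZoomLiouville`, crux E = stmt-NavierStokesRegularity-19832; class-free, `--supports` only)

`theorem hoopInequality : HoopCore.HoopInequality` — for every `C¹` divergence-free `V : ℝ³ → ℝ³` and every solid cylinder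
`Z = solidCyl s₁ s₂ T₀` (`s₁ < s₂`, `T₀ > 0`) about the radial `x₂`-axis,
`∫_Z hoopDensity V ≤ ∫_Z |DV|_F² + π ∫_{s₁}^{s₂} ‖V(σ e_z)‖² dσ + endFlux V s₁ T₀ + endFlux V s₂ T₀`
(ns-idea-11 g8's HOOP NOTE §4, typed by LEAD 19832 ns-typeII-p2 g14 in `…HoopDefs`; the first lever of the programme whose cost
and holding carry the same measure `dy/t²`).

Assembly of the K-HOOP split (LEAD key 01:25:31Z): ns-ezl-w2 g5's chart-free box inequality `HoopCore.hoop_box_le`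
(`…HoopBoxAssembly`: `hoop_circle_le` per circle — modes `m = 0, ±1, |m| ≥ 2` —, radial integration with the axis atom, and the
`σ`-integration by parts of the `∂_zV_z` term) instantiated with the slice chart of `…HoopSliceChart` / `…HoopSliceSides`
(ns-sfl-p1 g8; frame calculus of ns-ezl-w3 g6's `…HoopFrame` / `…HoopDensityBound`, cylinder and disc coordinates of ns-sfl-p1 g7's
`…HoopCylinder(Density)` / `…HoopDisc`):
`a = ⟪V∘axisPt, R_θe₀⟫`, `b = ⟪V∘axisPt, R_θe₁⟫`, `c = V_z∘axisPt`, `mr/mθ/mz = ⟪DV R_θe₁, R_θe₀ / R_θe₁ / e_z⟫`,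
`ad = ⟪DV R_θe₀, R_θe₀⟫`, `aσ = ⟪DV e_z, R_θe₀⟫`, `cσ = ⟪DV e_z, e_z⟫`; then
LHS = `∫_Z hoopDensity` (`setIntegral_hoopDensity_eq_sliceChart`), the four spent entries `≤ ∫_Z |DV|_F²`
(`sliceChart_fourEntries_le_frobenius`), the atom `≤ π∫‖V(σe_z)‖²` (`sliceChart_atom_le`), the ends `= endFlux`
(`sliceChart_endFlux`).

HONEST FRAME: ONE class-free functional inequality (a tool of the hoop / axis-law line); it is not a statement about Euler or
Navier–Stokes solutions; crux E (19832) OPEN; NS regularity NOT proved.  [ns-idea-11 g8 HOOP NOTE §4; folklore (azimuthal Fourier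
modes)]
-/

noncomputable section

open MeasureTheory Set WithLp Metric Real Function
open scoped InnerProductSpace RealInnerProductSpace

set_option linter.dupNamespace false

namespace Summit.NavierStokesRegularity.NavierStokesRegularity.Theorems.PowerGaugeEulerLiouville.HoopCore

open Literature.Analysis Literature.Analysis.FluidPDE Condenser

variable {V : EuclideanSpace ℝ (Fin 3) → EuclideanSpace ℝ (Fin 3)}

/-- **The box inequality for a `C¹` divergence-free field** (ns-ezl-w2 g5's `hoop_box_le` instantiated with the slice chart):
for `V ∈ C¹` with `div V = 0`, `s₁ ≤ s₂`, `T₀ > 0`,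
`∫σ∫₀^{T₀} t⁻¹∫(a² − b²) ≤ ∫σ∫₀^{T₀} t∫(mr² + mθ² + aσ² + mz²) + ∫σ E_σ(0) + ∫₀^{T₀}∫(a² + c²)(s₁) + ∫₀^{T₀}∫(a² + c²)(s₂)`
in the smooth frame `f₀ = R_θe₀`, `f₁ = R_θe₁`, `e_z`. [HOOP-NOTE §4] -/
theorem hoop_box_le_chart (hV : ContDiff ℝ 1 V) (hdiv : ∀ y, VectorCalculus.divergence V y = 0) {s₁ s₂ T₀ : ℝ}
    (hs : s₁ ≤ s₂) (hT₀ : 0 < T₀) :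
    ∫ σ in s₁..s₂, ∫ t in (0 : ℝ)..T₀, t⁻¹ * ∫ θ in (0 : ℝ)..2 * π,
        (⟪V (axisPt σ t θ), rotZ θ (EuclideanSpace.single (0 : Fin 3) (1 : ℝ))⟫ ^ 2 -
          ⟪V (axisPt σ t θ), rotZ θ (EuclideanSpace.single (1 : Fin 3) (1 : ℝ))⟫ ^ 2) ≤
      (∫ σ in s₁..s₂, ∫ t in (0 : ℝ)..T₀, t * ∫ θ in (0 : ℝ)..2 * π,
          (⟪fderiv ℝ V (axisPt σ t θ) (rotZ θ (EuclideanSpace.single (1 : Fin 3) (1 : ℝ))),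
              rotZ θ (EuclideanSpace.single (0 : Fin 3) (1 : ℝ))⟫ ^ 2 +
            ⟪fderiv ℝ V (axisPt σ t θ) (rotZ θ (EuclideanSpace.single (1 : Fin 3) (1 : ℝ))),
              rotZ θ (EuclideanSpace.single (1 : Fin 3) (1 : ℝ))⟫ ^ 2 +
            ⟪fderiv ℝ V (axisPt σ t θ) eZ, rotZ θ (EuclideanSpace.single (0 : Fin 3) (1 : ℝ))⟫ ^ 2 +
            ⟪fderiv ℝ V (axisPt σ t θ) (rotZ θ (EuclideanSpace.single (1 : Fin 3) (1 : ℝ))), eZ⟫ ^ 2))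
        + (∫ σ in s₁..s₂, π⁻¹ * ((∫ y in (0 : ℝ)..2 * π,
            ⟪V (axisPt σ 0 y), rotZ y (EuclideanSpace.single (0 : Fin 3) (1 : ℝ))⟫ * Real.cos y) ^ 2 +
          (∫ y in (0 : ℝ)..2 * π,
            ⟪V (axisPt σ 0 y), rotZ y (EuclideanSpace.single (0 : Fin 3) (1 : ℝ))⟫ * Real.sin y) ^ 2))
        + (∫ t in (0 : ℝ)..T₀, ∫ θ in (0 : ℝ)..2 * π,
            (⟪V (axisPt s₁ t θ), rotZ θ (EuclideanSpace.single (0 : Fin 3) (1 : ℝ))⟫ ^ 2 +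
              (axialVelocity V (axisPt s₁ t θ)) ^ 2))
        + (∫ t in (0 : ℝ)..T₀, ∫ θ in (0 : ℝ)..2 * π,
            (⟪V (axisPt s₂ t θ), rotZ θ (EuclideanSpace.single (0 : Fin 3) (1 : ℝ))⟫ ^ 2 +
              (axialVelocity V (axisPt s₂ t θ)) ^ 2)) := by
  have hVd : Differentiable ℝ V := hV.differentiable one_ne_zero
  have hVc : Continuous V := hV.continuous
  obtain ⟨C, hC⟩ := exists_mul_abs_hoopDensity_le_solidCyl hV s₁ s₂ hT₀
  exact hoop_box_le
    (a := fun σ t θ => ⟪V (axisPt σ t θ), rotZ θ (EuclideanSpace.single (0 : Fin 3) (1 : ℝ))⟫)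
    (b := fun σ t θ => ⟪V (axisPt σ t θ), rotZ θ (EuclideanSpace.single (1 : Fin 3) (1 : ℝ))⟫)
    (c := fun σ t θ => axialVelocity V (axisPt σ t θ))
    (ad := fun σ t θ => ⟪fderiv ℝ V (axisPt σ t θ) (rotZ θ (EuclideanSpace.single (0 : Fin 3) (1 : ℝ))),
      rotZ θ (EuclideanSpace.single (0 : Fin 3) (1 : ℝ))⟫)
    (aσ := fun σ t θ => ⟪fderiv ℝ V (axisPt σ t θ) eZ, rotZ θ (EuclideanSpace.single (0 : Fin 3) (1 : ℝ))⟫)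
    (cσ := fun σ t θ => ⟪fderiv ℝ V (axisPt σ t θ) eZ, eZ⟫)
    (mr := fun σ t θ => ⟪fderiv ℝ V (axisPt σ t θ) (rotZ θ (EuclideanSpace.single (1 : Fin 3) (1 : ℝ))),
      rotZ θ (EuclideanSpace.single (0 : Fin 3) (1 : ℝ))⟫)
    (mθ := fun σ t θ => ⟪fderiv ℝ V (axisPt σ t θ) (rotZ θ (EuclideanSpace.single (1 : Fin 3) (1 : ℝ))),
      rotZ θ (EuclideanSpace.single (1 : Fin 3) (1 : ℝ))⟫)
    (mz := fun σ t θ => ⟪fderiv ℝ V (axisPt σ t θ) (rotZ θ (EuclideanSpace.single (1 : Fin 3) (1 : ℝ))), eZ⟫)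
    (M := C * |2 * π - 0|) hs hT₀
    (fun σ t θ => hasDerivAt_sliceA_angle hVd σ t θ) (fun σ t θ => hasDerivAt_sliceB_angle hVd σ t θ)
    (fun σ t θ => hasDerivAt_sliceC_angle hVd σ t θ) (fun σ t θ => hasDerivAt_sliceA_radius hVd σ t θ)
    (fun σ t θ => hasDerivAt_sliceA_height hVd σ t θ) (fun σ t θ => hasDerivAt_sliceC_height hVd σ t θ)
    (continuous_sliceA hVc) (continuous_sliceB hVc) (continuous_sliceC hVc)
    (continuous_sliceEntry hV continuous_rotZ_single_zero continuous_rotZ_single_zero)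
    (continuous_sliceEntry hV continuous_const continuous_rotZ_single_zero)
    (continuous_sliceEntry hV continuous_const continuous_const)
    (continuous_sliceEntry hV continuous_rotZ_single_one continuous_rotZ_single_zero)
    (continuous_sliceEntry hV continuous_rotZ_single_one continuous_rotZ_single_one)
    (continuous_sliceEntry hV continuous_rotZ_single_one continuous_const)
    (fun σ t => by simp only [axisPt_two_pi, rotZ_two_pi_single_zero])
    (fun σ t => by simp only [axisPt_two_pi, rotZ_two_pi_single_one])
    (fun σ t => by simp only [axisPt_two_pi])
    (fun σ t θ => by
      have h := hdiv (axisPt σ t θ)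
      rw [divergence_eq_rotFrame V _ θ] at h
      linarith)
    (fun σ hσ t ht => by
      rw [← Real.norm_eq_abs]
      exact norm_sliceLHS_integrand_le hVc σ ht.1 fun θ => hC σ t θ hσ.1 hσ.2 ht.1 ht.2)

/-- The axis-atom integrand `σ ↦ E_σ(0)` is continuous (it equals `π((V σe_z)₀² + (V σe_z)₁²)`, `sliceChart_atom`). [folklore] -/
theorem continuous_sliceChart_atom (hV : Continuous V) :
    Continuous fun σ : ℝ => π⁻¹ * ((∫ y in (0 : ℝ)..2 * π,
        ⟪V (axisPt σ 0 y), rotZ y (EuclideanSpace.single (0 : Fin 3) (1 : ℝ))⟫ * Real.cos y) ^ 2 +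
      (∫ y in (0 : ℝ)..2 * π,
        ⟪V (axisPt σ 0 y), rotZ y (EuclideanSpace.single (0 : Fin 3) (1 : ℝ))⟫ * Real.sin y) ^ 2) := by
  simp_rw [sliceChart_atom]
  have hv : Continuous fun σ : ℝ => V (σ • eZ) := hV.comp (continuous_id.smul continuous_const)
  exact continuous_const.mul (((PiLp.continuous_apply 2 _ 0).comp hv |>.pow 2).add
    (((PiLp.continuous_apply 2 _ 1).comp hv).pow 2))

/-- **The integrated axis atom is at most `π ∫ ‖V(σ • e_z)‖²`** (`s₁ ≤ s₂`, `V` continuous). [folklore] -/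
theorem integral_sliceChart_atom_le (hV : Continuous V) {s₁ s₂ : ℝ} (hs : s₁ ≤ s₂) :
    ∫ σ in s₁..s₂, π⁻¹ * ((∫ y in (0 : ℝ)..2 * π,
        ⟪V (axisPt σ 0 y), rotZ y (EuclideanSpace.single (0 : Fin 3) (1 : ℝ))⟫ * Real.cos y) ^ 2 +
      (∫ y in (0 : ℝ)..2 * π,
        ⟪V (axisPt σ 0 y), rotZ y (EuclideanSpace.single (0 : Fin 3) (1 : ℝ))⟫ * Real.sin y) ^ 2) ≤
      Real.pi * ∫ σ in s₁..s₂, ‖V (σ • eZ)‖ ^ 2 := by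
  have hv : Continuous fun σ : ℝ => ‖V (σ • eZ)‖ ^ 2 := (hV.comp (continuous_id.smul continuous_const)).norm.pow 2
  rw [← intervalIntegral.integral_const_mul]
  exact intervalIntegral.integral_mono_on hs ((continuous_sliceChart_atom hV).intervalIntegrable _ _)
    ((continuous_const.mul hv).intervalIntegrable _ _) fun σ _ => sliceChart_atom_le V σ

/-- **THE HOOP INEQUALITY** (HOOP-NOTE §4; `HoopCore.HoopInequality` of `…HoopDefs`): for every `C¹` divergence-free `V` and
every solid cylinder `Z = solidCyl s₁ s₂ T₀` about the `x₂`-axis (`s₁ < s₂`, `0 < T₀`),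
`∫_Z hoopDensity V ≤ ∫_Z |DV|_F² + π ∫_{s₁}^{s₂} ‖V(σ e_z)‖² dσ + endFlux V s₁ T₀ + endFlux V s₂ T₀`.
Assembled from ns-ezl-w2 g5's `hoop_box_le` (circle inequality mode by mode, radial integration with the axis atom, `σ`-integration
by parts) and the slice chart (`setIntegral_hoopDensity_eq_sliceChart`, `sliceChart_fourEntries_le_frobenius`, `sliceChart_atom_le`,
`sliceChart_endFlux`).  A class-free tool; not a statement about Euler/NS solutions; 19832 OPEN. [ns-idea-11 g8 HOOP NOTE §4] -/
theorem hoopInequality : HoopInequality := by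
  intro V s₁ s₂ T₀ hs hT₀ hV hdiv
  have hVc : Continuous V := hV.continuous
  have hbox := hoop_box_le_chart hV hdiv hs.le hT₀
  have hF := sliceChart_fourEntries_le_frobenius hV hs.le hT₀.le
  have hA := integral_sliceChart_atom_le hVc hs.le
  have hE₁ := sliceChart_endFlux hVc s₁ hT₀
  have hE₂ := sliceChart_endFlux hVc s₂ hT₀
  -- reorder the four entries (`aσ² + mz²` versus `mz² + aσ²`)
  have hswap : (∫ σ in s₁..s₂, ∫ t in (0 : ℝ)..T₀, t * ∫ θ in (0 : ℝ)..2 * π,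
      (⟪fderiv ℝ V (axisPt σ t θ) (rotZ θ (EuclideanSpace.single (1 : Fin 3) (1 : ℝ))),
          rotZ θ (EuclideanSpace.single (0 : Fin 3) (1 : ℝ))⟫ ^ 2 +
        ⟪fderiv ℝ V (axisPt σ t θ) (rotZ θ (EuclideanSpace.single (1 : Fin 3) (1 : ℝ))),
          rotZ θ (EuclideanSpace.single (1 : Fin 3) (1 : ℝ))⟫ ^ 2 +
        ⟪fderiv ℝ V (axisPt σ t θ) eZ, rotZ θ (EuclideanSpace.single (0 : Fin 3) (1 : ℝ))⟫ ^ 2 +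
        ⟪fderiv ℝ V (axisPt σ t θ) (rotZ θ (EuclideanSpace.single (1 : Fin 3) (1 : ℝ))), eZ⟫ ^ 2)) =
      ∫ σ in s₁..s₂, ∫ t in (0 : ℝ)..T₀, t * ∫ θ in (0 : ℝ)..2 * π,
        (⟪fderiv ℝ V (axisPt σ t θ) (rotZ θ (EuclideanSpace.single (1 : Fin 3) (1 : ℝ))),
            rotZ θ (EuclideanSpace.single (0 : Fin 3) (1 : ℝ))⟫ ^ 2 +
          ⟪fderiv ℝ V (axisPt σ t θ) (rotZ θ (EuclideanSpace.single (1 : Fin 3) (1 : ℝ))),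
            rotZ θ (EuclideanSpace.single (1 : Fin 3) (1 : ℝ))⟫ ^ 2 +
          ⟪fderiv ℝ V (axisPt σ t θ) (rotZ θ (EuclideanSpace.single (1 : Fin 3) (1 : ℝ))), eZ⟫ ^ 2 +
          ⟪fderiv ℝ V (axisPt σ t θ) eZ, rotZ θ (EuclideanSpace.single (0 : Fin 3) (1 : ℝ))⟫ ^ 2) := by
    refine intervalIntegral.integral_congr fun σ _ => intervalIntegral.integral_congr fun t _ => ?_
    congr 1
    exact intervalIntegral.integral_congr fun θ _ => by ring
  rw [setIntegral_hoopDensity_eq_sliceChart hV hs.le hT₀]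
  rw [hswap] at hbox
  linarith

end Summit.NavierStokesRegularity.NavierStokesRegularity.Theorems.PowerGaugeEulerLiouville.HoopCore

end
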